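import Mathlib
import Summits.ValiantsHypothesis.ValiantsHypothesis.Theorems.NewtonUnitEquationsDissociatedUniformTotalsLawFibreSumProduct
import HarnessLib

/-!
# Crux `NewtonUnitEquations.DissociatedUniform` (stmt-ValiantsHypothesis-5905): the totals are EXACTLY additive over generic products —
# `T = |G₂|·T₁ + |G₁|·T₂`, so `T/|G|` adds up and `T/|G|²` never increases

Appendix to `…TotalsLawFibreSumProduct`.  There the generic-twist product configuration `prodCurve t` on `G₁ × G₂` was shown to satisfy
`T ≥ |G₂|T₁ + |G₁|T₂` (exact Minkowski count class by class) — enough to kill `FibreSumDominance C` for every `C`.  Here the converse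
inequality, valid for EVERY twist `t` (each class of the product is a Minkowski sum, and the tree's `ncard_extremePoints_add_le` bounds
its vertices by `V₁ + V₂`), and the resulting identity:
* `classVert_prod_le`, `totalVert_prod_le` (any `t`);
* `exists_twist_classVert_ge` (the lower bound of `…FibreSumProduct` with the twist exposed);
* **`exists_totalVert_prod_eq`**: if all classes of both factors have ≥ 2 hull vertices, some twist gives `T = |G₂|·T₁ + |G₁|·T₂` EXACTLY.
Consequence for the programme (memo NOTES-t1g10 §2): `T/|G|` is additive over such products, hence `T/|G|² = (T₁/|G₁|²)·|G₁|/|G| + …`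
only DECREASES — product configurations can never threaten `TotalsLawThree`, in contrast with the fibre-sum correction they destroy.
`TotalsLawThree C` remains OPEN; nothing here bears on VP ≠ VNP.
[folklore: vertices of planar Minkowski sums]
-/

set_option linter.dupNamespace false -- `ValiantsHypothesis.ValiantsHypothesis` (summit = problem) in every name

open scoped BigOperators Pointwise

namespace Summit.ValiantsHypothesis.ValiantsHypothesis.Theorems.NewtonUnitEquationsDissociatedUniform

namespace TotalsLaw

open Literature.Computability.AlgebraicComplexity.KPTT.PlanarMinkowski MinkowskiExact

section FibreSumProductExact

variable {G₁ G₂ : Type*} [AddCommGroup G₁] [Fintype G₁] [AddCommGroup G₂] [Fintype G₂]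

/-- **Upper bound for every twist**: a class of the product has at most `V₁ + V₂` hull vertices (Minkowski). [folklore] -/
theorem classVert_prod_le (t : ℝ) (a₁ b₁ c₁ : G₁ → (Fin 2 → ℝ)) (a₂ b₂ c₂ : G₂ → (Fin 2 → ℝ)) (s : G₁ × G₂) :
    classVert (prodCurve t a₁ a₂) (prodCurve t b₁ b₂) (prodCurve t c₁ c₂) s ≤ classVert a₁ b₁ c₁ s.1 + classVert a₂ b₂ c₂ s.2 := by
  classical
  have hne₁ : (clFin a₁ b₁ c₁ s.1).Nonempty := ⟨_, Finset.mem_image.2 ⟨(0, 0), Finset.mem_univ _, rfl⟩⟩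
  have hne₂ : ((clFin a₂ b₂ c₂ s.2).image (twist t)).Nonempty :=
    ⟨_, Finset.mem_image.2 ⟨_, Finset.mem_image.2 ⟨(0, 0), Finset.mem_univ _, rfl⟩, rfl⟩⟩
  have key := ncard_extremePoints_add_le hne₁ hne₂
  rw [ncard_extremePoints_image_twist] at key
  unfold classVert
  rw [classPts_prod, ← coe_clFin, ← coe_clFin, ← Finset.coe_image, ← Finset.coe_add]
  exact key

/-- **`T ≤ |G₂|·T₁ + |G₁|·T₂` for every twist.** [folklore] -/
theorem totalVert_prod_le (t : ℝ) (a₁ b₁ c₁ : G₁ → (Fin 2 → ℝ)) (a₂ b₂ c₂ : G₂ → (Fin 2 → ℝ)) :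
    totalVert (prodCurve t a₁ a₂) (prodCurve t b₁ b₂) (prodCurve t c₁ c₂) ≤
      Fintype.card G₂ * totalVert a₁ b₁ c₁ + Fintype.card G₁ * totalVert a₂ b₂ c₂ := by
  unfold totalVert
  calc ∑ s : G₁ × G₂, classVert (prodCurve t a₁ a₂) (prodCurve t b₁ b₂) (prodCurve t c₁ c₂) s
      ≤ ∑ s : G₁ × G₂, (classVert a₁ b₁ c₁ s.1 + classVert a₂ b₂ c₂ s.2) :=
        Finset.sum_le_sum fun s _ => classVert_prod_le t a₁ b₁ c₁ a₂ b₂ c₂ s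
    _ = Fintype.card G₂ * ∑ s, classVert a₁ b₁ c₁ s + Fintype.card G₁ * ∑ s, classVert a₂ b₂ c₂ s := by
        rw [Finset.sum_add_distrib, Fintype.sum_prod_type, Fintype.sum_prod_type]
        simp only [Finset.sum_const, Finset.card_univ, smul_eq_mul]
        rw [Finset.mul_sum, Finset.mul_sum]

/-- **Lower bound with the twist exposed**: off the finitely many bad twists every class of the product has at least `V₁ + V₂` hull
vertices (the argument of `…FibreSumProduct.exists_prod_config`). [folklore] -/
theorem exists_twist_classVert_ge (a₁ b₁ c₁ : G₁ → (Fin 2 → ℝ)) (a₂ b₂ c₂ : G₂ → (Fin 2 → ℝ))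
    (h₁ : ∀ s, 2 ≤ classVert a₁ b₁ c₁ s) (h₂ : ∀ s, 2 ≤ classVert a₂ b₂ c₂ s) :
    ∃ t : ℝ, ∀ s : G₁ × G₂, classVert a₁ b₁ c₁ s.1 + classVert a₂ b₂ c₂ s.2 ≤
      classVert (prodCurve t a₁ a₂) (prodCurve t b₁ b₂) (prodCurve t c₁ c₂) s := by
  classical
  set B : Finset ℝ := (Finset.univ : Finset (G₁ × G₂)).biUnion fun s =>
      ((clFin a₁ b₁ c₁ s.1 ×ˢ clFin a₁ b₁ c₁ s.1) ×ˢ (clFin a₂ b₂ c₂ s.2 ×ˢ clFin a₂ b₂ c₂ s.2)).image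
        fun pq => badT (pq.1.1 - pq.1.2) (pq.2.1 - pq.2.2) with hB
  obtain ⟨t, ht⟩ := Infinite.exists_notMem_finset B
  refine ⟨t, fun s => ?_⟩
  have hX := exists_pair_of_two_le_classVert (h₁ s.1)
  obtain ⟨u₀, hu₀, v₀, hv₀, huv₀⟩ := exists_pair_of_two_le_classVert (h₂ s.2)
  have hY : ∃ u ∈ (clFin a₂ b₂ c₂ s.2).image (twist t), ∃ v ∈ (clFin a₂ b₂ c₂ s.2).image (twist t), u ≠ v :=
    ⟨twist t u₀, Finset.mem_image_of_mem _ hu₀, twist t v₀, Finset.mem_image_of_mem _ hv₀,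
      fun h => huv₀ (twist_injective t h)⟩
  have hGP : ∀ p ∈ clFin a₁ b₁ c₁ s.1, ∀ q ∈ clFin a₁ b₁ c₁ s.1, ∀ u ∈ (clFin a₂ b₂ c₂ s.2).image (twist t),
      ∀ v ∈ (clFin a₂ b₂ c₂ s.2).image (twist t), p ≠ q → u ≠ v → cross (p - q) (u - v) ≠ 0 := by
    intro p hp q hq u hu v hv hpq huv
    obtain ⟨u₁, hu₁, rfl⟩ := Finset.mem_image.1 hu
    obtain ⟨v₁, hv₁, rfl⟩ := Finset.mem_image.1 hv
    rw [← twist_sub]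
    refine cross_twist_ne_zero (sub_ne_zero.2 hpq) (sub_ne_zero.2 fun h => huv (by rw [h])) fun hbad => ht ?_
    rw [hB, Finset.mem_biUnion]
    refine ⟨s, Finset.mem_univ _, Finset.mem_image.2 ⟨((p, q), (u₁, v₁)), ?_, hbad.symm⟩⟩
    simp only [Finset.mem_product]
    exact ⟨⟨hp, hq⟩, hu₁, hv₁⟩
  have key := add_le_ncard_extremePoints_add (clFin a₁ b₁ c₁ s.1) ((clFin a₂ b₂ c₂ s.2).image (twist t)) hX hY hGP
  rw [ncard_extremePoints_image_twist] at key
  unfold classVert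
  rw [classPts_prod, ← coe_clFin, ← coe_clFin, ← Finset.coe_image, ← Finset.coe_add]
  exact key

/-- **Exact product totals**: for configurations all of whose classes have at least two hull vertices, some twist gives
`T = |G₂|·T₁ + |G₁|·T₂` exactly — `T/|G|` is additive over generic products. [folklore] -/
theorem exists_totalVert_prod_eq (a₁ b₁ c₁ : G₁ → (Fin 2 → ℝ)) (a₂ b₂ c₂ : G₂ → (Fin 2 → ℝ))
    (h₁ : ∀ s, 2 ≤ classVert a₁ b₁ c₁ s) (h₂ : ∀ s, 2 ≤ classVert a₂ b₂ c₂ s) :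
    ∃ t : ℝ, totalVert (prodCurve t a₁ a₂) (prodCurve t b₁ b₂) (prodCurve t c₁ c₂) =
      Fintype.card G₂ * totalVert a₁ b₁ c₁ + Fintype.card G₁ * totalVert a₂ b₂ c₂ := by
  obtain ⟨t, ht⟩ := exists_twist_classVert_ge a₁ b₁ c₁ a₂ b₂ c₂ h₁ h₂
  refine ⟨t, le_antisymm (totalVert_prod_le t a₁ b₁ c₁ a₂ b₂ c₂) ?_⟩
  have hsum : Fintype.card G₂ * totalVert a₁ b₁ c₁ + Fintype.card G₁ * totalVert a₂ b₂ c₂ =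
      ∑ s : G₁ × G₂, (classVert a₁ b₁ c₁ s.1 + classVert a₂ b₂ c₂ s.2) := by
    unfold totalVert
    rw [Finset.sum_add_distrib, Fintype.sum_prod_type, Fintype.sum_prod_type]
    simp only [Finset.sum_const, Finset.card_univ, smul_eq_mul]
    rw [Finset.mul_sum, Finset.mul_sum]
  rw [hsum]
  unfold totalVert
  exact Finset.sum_le_sum fun s _ => ht s

/-- **Product closure of quadratic totals bounds.**  If the factors satisfy `T_i ≤ C·|G_i|²` then every twisted product satisfies
`T ≤ C·|G₁ × G₂|²` (indeed `≤ C|G₁||G₂|(|G₁|+|G₂|)`): products respect the shape of `TotalsLawThree`. [folklore] -/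
theorem totalVert_prod_le_of_sq {C : ℕ} (t : ℝ) (a₁ b₁ c₁ : G₁ → (Fin 2 → ℝ)) (a₂ b₂ c₂ : G₂ → (Fin 2 → ℝ))
    (hT₁ : totalVert a₁ b₁ c₁ ≤ C * Fintype.card G₁ ^ 2) (hT₂ : totalVert a₂ b₂ c₂ ≤ C * Fintype.card G₂ ^ 2)
    (hG₁ : 2 ≤ Fintype.card G₁) (hG₂ : 2 ≤ Fintype.card G₂) :
    totalVert (prodCurve t a₁ a₂) (prodCurve t b₁ b₂) (prodCurve t c₁ c₂) ≤ C * Fintype.card (G₁ × G₂) ^ 2 := by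
  have h := totalVert_prod_le t a₁ b₁ c₁ a₂ b₂ c₂
  rw [Fintype.card_prod]
  have e1 : Fintype.card G₂ * totalVert a₁ b₁ c₁ ≤ Fintype.card G₂ * (C * Fintype.card G₁ ^ 2) := Nat.mul_le_mul_left _ hT₁
  have e2 : Fintype.card G₁ * totalVert a₂ b₂ c₂ ≤ Fintype.card G₁ * (C * Fintype.card G₂ ^ 2) := Nat.mul_le_mul_left _ hT₂
  have e3 : Fintype.card G₁ + Fintype.card G₂ ≤ Fintype.card G₁ * Fintype.card G₂ := by nlinarith
  have e4 : C * (Fintype.card G₁ * Fintype.card G₂ * (Fintype.card G₁ + Fintype.card G₂)) ≤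
      C * (Fintype.card G₁ * Fintype.card G₂ * (Fintype.card G₁ * Fintype.card G₂)) :=
    Nat.mul_le_mul_left _ (Nat.mul_le_mul_left _ e3)
  nlinarith

end FibreSumProductExact

end TotalsLaw

end Summit.ValiantsHypothesis.ValiantsHypothesis.Theorems.NewtonUnitEquationsDissociatedUniform
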